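import Summits.Ventures.CertifiedManyBodySolver.Lower.PauliDoublonFloor
import Literature.MathematicalPhysics.QuantumLattice.HubbardTorus2DEnergyDensityConvex
import Mathlib.MeasureTheory.Integral.IntervalIntegral.Periodic
import Mathlib.MeasureTheory.Integral.Prod
import Literature.Probability.LatticeModels.LatticePotentialKernelDiagonal
import HarnessLib

/-!
# Ventures/CertifiedManyBodySolver — Lower/PauliDoublonRealDensity.lean: convexity of the block floor and the Pauli–doublon floor at ALL real densities

HONEST FRAMING: first certified bounds; not a superconductivity verdict; every number certified or labelled float.

Part 5 of the Pauli–doublon (doped Langer–Mattis) floor (parts 1–4: `Lower/PauliDoublonBlock.lean`,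
`…LevelProj.lean`, `…OperatorIdentity.lean`, `…Floor.lean`). Two add-ons, theorem-only apart from the one statement
`TLBoundReal`: (i) `convexOn_blockFloor` — the integrand `s̃(ε; U, κ, α, ν)` is CONVEX in the band energy `ε` for
`0 ≤ κ ≤ 1` (sum of negative parts of `h ± g` = a maximum of affine functions and a Euclidean norm of an affine map),
the fact behind the chord-cell certified quadrature of the class-K engines; (ii) `tlBoundReal_holds` / `tlBound_holds` — THEOREM E at
EVERY real density `0 ≤ n < 2` (`U ≥ 0`, all real `t, α, ν`):
`e(t, U, n) ≥ −2 (α n/2 + (2π)⁻² ∫_{[−π,π]²} s̃(2t(cos p₁ + cos p₂); U, n/2, α, ν) dp)`, from `tlBoundRat_holds` by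
density of the rationals: the left side is continuous in `n` (parametric integral of the jointly continuous integrand
over the compact Brillouin zone), the right side is convex on `[0, 2)` (`convexOn_energyDensity2D`) hence continuous on
`(0, 2)`, and `n = 0` is rational; (iii) the Brillouin-zone sign flip `integral_pdbIntegrand_neg_hopping`
(`∫ s̃(−2tΣcos) = ∫ s̃(+2tΣcos)`, Fubini + `∫_{−π}^{π} G(−cos x) dx = ∫ G(cos x) dx`) giving the `+t` normal form
`TLBound` / `tlBound_holds` exactly as first stated in NOTE-PDB-L §6 (E); (iv) the chord-cell bound `blockFloor_le_chord` /
`setIntegral_blockFloor_le_chord` used by the certified 2-D quadratures (convexity ⇒ the integrand lies below its chord on every cell). Print placement as in part 4 (half filling [cite: LangerMattis1971, eqs. (3)–(5)];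
off half filling the mechanism of [cite: ValentiStolzeHirschfeld1991, bound type (b)], Falicov–Kimball input unread —
a kernel theorem of that printed class, not a result new in print). Mathematics and Lean proofs: hubbard-alg L3 seat B (planner-sr-mbsolver-l3-idea-2 g26, `PauliDoublonSketch.lean` v8 sha16 9906d31e65cfdd0c + the RealDensity / PART5-BZ / ChordBound add-ons = v10; v11 sha16 24852083496c0d24 adds only a half-filling closed-form section not included here); tree placement and citations: LIT lane (literature-prover lit-1 g22). 0 sorry.
-/

noncomputable section

namespace Summit.Ventures.CertifiedManyBodySolver.Lower

namespace PauliDoublon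

open Literature.MathematicalPhysics.QuantumLattice
open Matrix Finset Filter Literature.Probability.LatticeModels ThermodynamicLimit LangerMattis MeasureTheory
open scoped Topology ComplexOrder

/-! ### Convexity of the block floor in the band energy `ε` (the fact behind the chord-cell quadrature). -/

/-- Sum of the negative parts of `h ± g` (`g ≥ 0`) as a maximum of three pieces. [folklore] -/
theorem negparts_eq_max3 (h g : ℝ) (hg : 0 ≤ g) :
    max (-(h + g)) 0 + max (-(h - g)) 0 = max (max (-2 * h) (g - h)) 0 := by
  simp only [max_def]
  split_ifs <;> linarith

/-- An affine function of one real variable is convex. [folklore] -/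
theorem convexOn_affine (m c : ℝ) : ConvexOn ℝ Set.univ (fun ε : ℝ => m * ε + c) := by
  refine ⟨convex_univ, fun x _ y _ a b _ _ hab => ?_⟩
  simp only [smul_eq_mul]
  exact le_of_eq (by linear_combination (-c) * hab)

/-- `ε ↦ √((Aε+B)² + D(ε+ν)²)` (`D ≥ 0`) is convex: it is the Euclidean norm of an affine map
(proved by hand via the two-dimensional Cauchy–Schwarz inequality). [folklore] -/
theorem convexOn_sqrt_quad (A B D ν : ℝ) (hD : 0 ≤ D) :
    ConvexOn ℝ Set.univ (fun ε : ℝ => Real.sqrt ((A * ε + B) ^ 2 + D * (ε + ν) ^ 2)) := by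
  refine ⟨convex_univ, fun x _ y _ a b ha hb hab => ?_⟩
  simp only [smul_eq_mul]
  obtain ⟨C, hC⟩ : ∃ C : ℝ, C = Real.sqrt D := ⟨_, rfl⟩
  have hC2 : C ^ 2 = D := by rw [hC]; exact Real.sq_sqrt hD
  obtain ⟨u₁, hu₁⟩ : ∃ q : ℝ, q = A * x + B := ⟨_, rfl⟩
  obtain ⟨u₂, hu₂⟩ : ∃ q : ℝ, q = C * (x + ν) := ⟨_, rfl⟩
  obtain ⟨v₁, hv₁⟩ : ∃ q : ℝ, q = A * y + B := ⟨_, rfl⟩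
  obtain ⟨v₂, hv₂⟩ : ∃ q : ℝ, q = C * (y + ν) := ⟨_, rfl⟩
  have hux : (A * x + B) ^ 2 + D * (x + ν) ^ 2 = u₁ ^ 2 + u₂ ^ 2 := by
    rw [← hC2, hu₁, hu₂]; ring
  have hvy : (A * y + B) ^ 2 + D * (y + ν) ^ 2 = v₁ ^ 2 + v₂ ^ 2 := by
    rw [← hC2, hv₁, hv₂]; ring
  have hmix : (A * (a * x + b * y) + B) ^ 2 + D * (a * x + b * y + ν) ^ 2
      = (a * u₁ + b * v₁) ^ 2 + (a * u₂ + b * v₂) ^ 2 := by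
    rw [← hC2, hu₁, hu₂, hv₁, hv₂]
    have hb' : b = 1 - a := by linarith
    rw [hb']
    ring
  rw [hux, hvy, hmix]
  obtain ⟨gx, hgx⟩ : ∃ q : ℝ, q = Real.sqrt (u₁ ^ 2 + u₂ ^ 2) := ⟨_, rfl⟩
  obtain ⟨gy, hgy⟩ : ∃ q : ℝ, q = Real.sqrt (v₁ ^ 2 + v₂ ^ 2) := ⟨_, rfl⟩
  rw [← hgx, ← hgy]
  have hgx0 : 0 ≤ gx := by rw [hgx]; exact Real.sqrt_nonneg _
  have hgy0 : 0 ≤ gy := by rw [hgy]; exact Real.sqrt_nonneg _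
  have hgx2 : gx ^ 2 = u₁ ^ 2 + u₂ ^ 2 := by rw [hgx]; exact Real.sq_sqrt (by positivity)
  have hgy2 : gy ^ 2 = v₁ ^ 2 + v₂ ^ 2 := by rw [hgy]; exact Real.sq_sqrt (by positivity)
  -- Cauchy–Schwarz in the plane
  have hCS : u₁ * v₁ + u₂ * v₂ ≤ gx * gy := by
    have hsq : (u₁ * v₁ + u₂ * v₂) ^ 2 ≤ (gx * gy) ^ 2 := by
      rw [mul_pow, hgx2, hgy2]; nlinarith [sq_nonneg (u₁ * v₂ - u₂ * v₁)]
    have h1 := Real.sqrt_le_sqrt hsq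
    rw [Real.sqrt_sq_eq_abs, Real.sqrt_sq (mul_nonneg hgx0 hgy0)] at h1
    exact le_trans (le_abs_self _) h1
  have hprod : 2 * a * b * (u₁ * v₁ + u₂ * v₂) ≤ 2 * a * b * (gx * gy) :=
    mul_le_mul_of_nonneg_left hCS (by positivity)
  have hR : 0 ≤ a * gx + b * gy := by positivity
  rw [show a * gx + b * gy = Real.sqrt ((a * gx + b * gy) ^ 2) from (Real.sqrt_sq hR).symm]
  apply Real.sqrt_le_sqrt
  have e : (a * gx + b * gy) ^ 2 = a ^ 2 * gx ^ 2 + 2 * a * b * (gx * gy) + b ^ 2 * gy ^ 2 := by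
    ring
  rw [e, hgx2, hgy2]
  linarith

/-- **The block floor is convex in the band energy.** For `0 ≤ κ ≤ 1`,
`blockFloor = max(-2·half, disc - half, 0)` with `half` affine and `disc` the Euclidean norm of an
affine map of `ε`. This is what makes the chord-cell upper Riemann sums of the engines rigorous. [folklore] -/
theorem convexOn_blockFloor (U κ α ν : ℝ) (hκ0 : 0 ≤ κ) (hκ1 : κ ≤ 1) :
    ConvexOn ℝ Set.univ (fun ε : ℝ => blockFloor ε U κ α ν) := by
  have hD : 0 ≤ (1 - κ) * κ := mul_nonneg (by linarith) hκ0
  -- the three pieces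
  have h1 : ConvexOn ℝ Set.univ (fun ε : ℝ => -2 * (((1 - κ) * (ε + α) + κ * (ε + α + U / 2)) / 2)) :=
    (convexOn_affine (-1) (-((1 - κ) * α + κ * (α + U / 2)))).congr (by intro ε _; simp only; ring)
  have h2 : ConvexOn ℝ Set.univ (fun ε : ℝ =>
      Real.sqrt (((1 - κ) * (ε + α) - κ * (ε + α + U / 2)) ^ 2 / 4 + (1 - κ) * κ * (ε + ν) ^ 2)
        - ((1 - κ) * (ε + α) + κ * (ε + α + U / 2)) / 2) := by
    have hs := convexOn_sqrt_quad ((1 - 2 * κ) / 2) (((1 - κ) * α - κ * (α + U / 2)) / 2)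
      ((1 - κ) * κ) ν hD
    have ha := convexOn_affine (-1 / 2) (-((1 - κ) * α + κ * (α + U / 2)) / 2)
    refine (hs.add ha).congr ?_
    intro ε _
    simp only [Pi.add_apply]
    have hr : ((1 - 2 * κ) / 2 * ε + ((1 - κ) * α - κ * (α + U / 2)) / 2) ^ 2 + (1 - κ) * κ * (ε + ν) ^ 2
        = ((1 - κ) * (ε + α) - κ * (ε + α + U / 2)) ^ 2 / 4 + (1 - κ) * κ * (ε + ν) ^ 2 := by ring
    rw [hr]
    ring
  have h3 := (h1.sup h2).sup (convexOn_const (0 : ℝ) convex_univ)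
  refine h3.congr ?_
  intro ε _
  simp only [Pi.sup_apply]
  dsimp only [blockFloor]
  rw [negparts_eq_max3 _ _ (Real.sqrt_nonneg _)]


/-! ### All real densities: `TLBoundReal` from `TLBoundRat` by density of the rationals. -/

/-- THEOREM E at ALL real densities `0 ≤ n < 2` (same normal form as `TLBoundRat`, integrand at
hopping `-t`, i.e. `blockFloor (2t Σ cos pᵢ) …`). [folklore] -/
def TLBoundReal : Prop :=
  ∀ (t : ℝ) (U : ℝ), 0 ≤ U → ∀ (n : ℝ), 0 ≤ n → n < 2 → ∀ (α ν : ℝ),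
    -(2 * (α * (n / 2) +
        ((2 * Real.pi) ^ 2)⁻¹ * ∫ p in brillouin 2, pdbIntegrand (-t) U (n / 2) α ν p)) ≤
      energyDensity2D t U n

/-- Density step: an inequality `F ≤ e` between two functions continuous at `n ∈ (0,2)` that holds
at every rational density of `[0,2)` holds at `n` (approximate `n` from below by `⌊n(k+1)⌋/(k+1)`). [folklore] -/
theorem le_of_forall_ratDensity {F e : ℝ → ℝ} {n : ℝ} (hn0 : 0 < n) (hn2 : n < 2)
    (hF : ContinuousAt F n) (he : ContinuousAt e n)
    (h : ∀ x : ℝ, 0 ≤ x → x < 2 → (∃ a q : ℕ, 0 < q ∧ x = a / q) → F x ≤ e x) : F n ≤ e n := by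
  obtain ⟨q, hq⟩ : ∃ q : ℕ → ℝ, ∀ k, q k = (⌊n * (k + 1)⌋₊ : ℝ) / (k + 1) := ⟨_, fun k => rfl⟩
  have hq_le : ∀ k, q k ≤ n := by
    intro k
    have hk : (0 : ℝ) < k + 1 := by positivity
    rw [hq, div_le_iff₀ hk]
    exact Nat.floor_le (by positivity)
  have hq_ge : ∀ k : ℕ, n - 1 / ((k : ℝ) + 1) ≤ q k := by
    intro k
    have hk : (0 : ℝ) < k + 1 := by positivity
    rw [hq, le_div_iff₀ hk, sub_mul, div_mul_cancel₀ _ hk.ne']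
    have := Nat.lt_floor_add_one (n * (k + 1))
    linarith
  have hq_tendsto : Tendsto q atTop (𝓝 n) := by
    have h1 : Tendsto (fun k : ℕ => n - 1 / ((k : ℝ) + 1)) atTop (𝓝 n) := by
      have h0 := (tendsto_const_nhds (x := n) (f := (atTop : Filter ℕ))).sub
        tendsto_one_div_add_atTop_nhds_zero_nat
      rw [sub_zero] at h0
      exact h0
    exact tendsto_of_tendsto_of_tendsto_of_le_of_le h1 tendsto_const_nhds
      (fun k => hq_ge k) (fun k => hq_le k)
  have hFq : Tendsto (fun k => F (q k)) atTop (𝓝 (F n)) := hF.tendsto.comp hq_tendsto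
  have heq : Tendsto (fun k => e (q k)) atTop (𝓝 (e n)) := he.tendsto.comp hq_tendsto
  refine le_of_tendsto_of_tendsto' hFq heq fun k => ?_
  have hk : (0 : ℝ) < k + 1 := by positivity
  refine h (q k) (by rw [hq]; positivity) (lt_of_le_of_lt (hq_le k) hn2)
    ⟨⌊n * (k + 1)⌋₊, k + 1, Nat.succ_pos k, ?_⟩
  rw [hq]
  push_cast
  ring

/-- `TLBoundRat → TLBoundReal`: the left side is continuous in the density (parametric integral of
the jointly continuous `pdbIntegrand` over the compact Brillouin zone), the right side is convex on
`[0,2)` (`convexOn_energyDensity2D`) hence continuous on `(0,2)`; `n = 0` is rational. [folklore] -/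
theorem tlBoundReal_of_tlBoundRat (h : TLBoundRat) : TLBoundReal := by
  intro t U hU n hn0 hn2 α ν
  rcases hn0.eq_or_lt with h0 | hpos
  · exact h t U hU n hn0 hn2 ⟨0, 1, one_pos, by rw [← h0]; simp⟩ α ν
  -- continuity of the PDB side in the density
  have hG : Continuous fun κ : ℝ => ∫ p in brillouin 2, pdbIntegrand (-t) U κ α ν p := by
    refine continuous_parametric_integral_of_continuous ?_ (isCompact_brillouin 2)
    show Continuous fun x : ℝ × (Fin 2 → ℝ) => pdbIntegrand (-t) U x.1 α ν x.2
    unfold pdbIntegrand blockFloor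
    dsimp only
    fun_prop
  have hG2 : Continuous fun x : ℝ => ∫ p in brillouin 2, pdbIntegrand (-t) U (x / 2) α ν p :=
    hG.comp (continuous_id.div_const 2)
  have hFc : Continuous fun x : ℝ => -(2 * (α * (x / 2) +
      ((2 * Real.pi) ^ 2)⁻¹ * ∫ p in brillouin 2, pdbIntegrand (-t) U (x / 2) α ν p)) :=
    (continuous_const.mul ((continuous_const.mul (continuous_id.div_const 2)).add
      (continuous_const.mul hG2))).neg
  -- continuity of the energy density on the open interval
  have hec : ContinuousAt (energyDensity2D t U) n := by
    have hc := (convexOn_energyDensity2D t hU).continuousOn_interior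
    rw [interior_Ico] at hc
    exact hc.continuousAt (Ioo_mem_nhds hpos hn2)
  exact le_of_forall_ratDensity (F := fun x : ℝ => -(2 * (α * (x / 2) +
      ((2 * Real.pi) ^ 2)⁻¹ * ∫ p in brillouin 2, pdbIntegrand (-t) U (x / 2) α ν p)))
    (e := energyDensity2D t U) hpos hn2 hFc.continuousAt hec
    (fun x hx0 hx2 hq => h t U hU x hx0 hx2 hq α ν)

/-- **The PDB-L lower bound at all real densities `0 ≤ n < 2`, unconditionally.** [folklore] -/
theorem tlBoundReal_holds : TLBoundReal :=
  tlBoundReal_of_tlBoundRat tlBoundRat_holds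


/-- THEOREM E (thermodynamic limit, `d = 2`), `+t` normal form: for `U ≥ 0`, `0 ≤ n < 2` and ALL
real `α, ν`, `e(t,U,n) ≥ -2 (α n/2 + (2π)⁻² ∫_{[-π,π]²} s̃(ε(p); n/2, α, ν, U) dp)` with the band at
hopping `+t` inside `pdbIntegrand t`. Equivalent to `TLBoundReal` by the Brillouin-zone sign flip
`integral_pdbIntegrand_neg_hopping`. [folklore] -/
def TLBound : Prop :=
  ∀ (t : ℝ) (U : ℝ), 0 ≤ U → ∀ (n : ℝ), 0 ≤ n → n < 2 → ∀ (α ν : ℝ),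
    -(2 * (α * (n / 2) +
        ((2 * Real.pi) ^ 2)⁻¹ * ∫ p in brillouin 2, pdbIntegrand t U (n / 2) α ν p)) ≤
      energyDensity2D t U n

/-! ### The Brillouin-zone sign flip `t ↦ -t` and the `+t` normal form `TLBound`. -/
section BZShift
open Real intervalIntegral

/-- `∫_{-π}^{π} G(-cos x) dx = ∫_{-π}^{π} G(cos x) dx` (shift by `π` + `2π`-periodicity; no
integrability needed). [folklore] -/
theorem intervalIntegral_comp_neg_cos (G : ℝ → ℝ) :
    ∫ x in (-π)..π, G (-Real.cos x) = ∫ x in (-π)..π, G (Real.cos x) := by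
  have h1 : ∫ x in (-π)..π, G (-Real.cos x) = ∫ x in (-π)..π, (fun x => G (Real.cos x)) (x + π) := by
    simp only [Real.cos_add_pi]
  rw [h1, intervalIntegral.integral_comp_add_right (fun x => G (Real.cos x)) π]
  have hp : Function.Periodic (fun x => G (Real.cos x)) (2 * π) := fun x => by
    simp only [Real.cos_add_two_pi]
  have h2 := hp.intervalIntegral_add_eq (-π) 0
  rw [show -π + π = 0 by ring, show π + π = 0 + 2 * π by ring, ← h2, show -π + 2 * π = π by ring]

/-- A Brillouin-zone integral of `g(cos p₀, cos p₁)`-type as an iterated interval integral. [folklore] -/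
theorem integral_brillouin_two_eq_iterated (f : ℝ → ℝ → ℝ)
    (hf : Continuous fun q : ℝ × ℝ => f q.1 q.2) :
    ∫ p in brillouin 2, f (p 0) (p 1) = ∫ x in (-π)..π, ∫ y in (-π)..π, f x y := by
  have h := (volume_preserving_finTwoArrow ℝ).setIntegral_preimage_emb
    (MeasurableEquiv.finTwoArrow : (Fin 2 → ℝ) ≃ᵐ ℝ × ℝ).measurableEmbedding
    (fun q : ℝ × ℝ => f q.1 q.2) (Set.Icc (-π) π ×ˢ Set.Icc (-π) π)
  rw [← Literature.Probability.LatticeModels.PotentialKernelDiagonal.brillouin_two_eq_preimage] at h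
  have h' : ∫ p in brillouin 2, f (p 0) (p 1) =
      ∫ q in Set.Icc (-π) π ×ˢ Set.Icc (-π) π, f q.1 q.2 := by
    rw [← h]; rfl
  rw [h', Measure.volume_eq_prod, setIntegral_prod]
  · have hπ : -π ≤ π := by linarith [Real.pi_pos]
    rw [intervalIntegral.integral_of_le hπ, ← integral_Icc_eq_integral_Ioc]
    refine setIntegral_congr_fun measurableSet_Icc fun x _ => ?_
    rw [intervalIntegral.integral_of_le hπ, ← integral_Icc_eq_integral_Ioc]
  · rw [← Measure.volume_eq_prod]
    exact hf.continuousOn.integrableOn_compact (isCompact_Icc.prod isCompact_Icc)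

/-- **Sign flip of the band.** For continuous `g`,
`∫_{BZ} g(-(cos p₀ + cos p₁)) dp = ∫_{BZ} g(cos p₀ + cos p₁) dp`. [folklore] -/
theorem integral_brillouin_two_sum_cos_neg (g : ℝ → ℝ) (hg : Continuous g) :
    ∫ p in brillouin 2, g (-(∑ i, Real.cos (p i))) = ∫ p in brillouin 2, g (∑ i, Real.cos (p i)) := by
  simp only [Fin.sum_univ_two]
  have hL := integral_brillouin_two_eq_iterated (fun x y => g (-(Real.cos x + Real.cos y)))
    (by fun_prop)
  have hR := integral_brillouin_two_eq_iterated (fun x y => g (Real.cos x + Real.cos y))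
    (by fun_prop)
  rw [hL, hR]
  -- flip the inner variable, then the outer one
  have hin : ∀ x : ℝ, ∫ y in (-π)..π, g (-(Real.cos x + Real.cos y)) =
      ∫ y in (-π)..π, g (-Real.cos x + Real.cos y) := by
    intro x
    have := intervalIntegral_comp_neg_cos (fun c => g (-Real.cos x + c))
    rw [← this]
    congr 1; ext y; ring_nf
  simp_rw [hin]
  exact intervalIntegral_comp_neg_cos (fun c => ∫ y in (-π)..π, g (c + Real.cos y))

/-- The PDB integral does not see the sign of the hopping (BZ shift `p ↦ p + (π,π)`). [folklore] -/
theorem integral_pdbIntegrand_neg_hopping (t U κ α ν : ℝ) :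
    ∫ p in brillouin 2, pdbIntegrand (-t) U κ α ν p = ∫ p in brillouin 2, pdbIntegrand t U κ α ν p := by
  have hc : Continuous fun c : ℝ => blockFloor (-(t * (2 * c))) U κ α ν := by
    unfold blockFloor; dsimp only; fun_prop
  calc ∫ p in brillouin 2, pdbIntegrand (-t) U κ α ν p
      = ∫ p in brillouin 2, (fun c : ℝ => blockFloor (-(t * (2 * c))) U κ α ν)
          (-(∑ i, Real.cos (p i))) :=
        setIntegral_congr_fun (measurableSet_brillouin 2) fun p _ => by
          simp only [pdbIntegrand]; congr 1; ring
    _ = ∫ p in brillouin 2, (fun c : ℝ => blockFloor (-(t * (2 * c))) U κ α ν) (∑ i, Real.cos (p i)) :=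
        integral_brillouin_two_sum_cos_neg _ hc
    _ = ∫ p in brillouin 2, pdbIntegrand t U κ α ν p :=
        setIntegral_congr_fun (measurableSet_brillouin 2) fun p _ => by simp only [pdbIntegrand]

end BZShift

/-- `TLBoundReal → TLBound` (the `+t` normal form of the statement). [folklore] -/
theorem tlBound_of_tlBoundReal (h : TLBoundReal) : TLBound := by
  intro t U hU n hn0 hn2 α ν
  rw [← integral_pdbIntegrand_neg_hopping]
  exact h t U hU n hn0 hn2 α ν

/-- **THEOREM E as originally stated (`TLBound`, all real densities, `+t` form), unconditionally.** [folklore] -/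
theorem tlBound_holds : TLBound :=
  tlBound_of_tlBoundReal tlBoundReal_holds

/-! ### Chord inequality for the block floor (the one analytic input of the 2-D chord-cell quadrature)
On any level window `lo ≤ ε ≤ hi` (`lo < hi`) the integrand lies below the chord through
`(lo, blockFloor lo)` and `(hi, blockFloor hi)`; integrating over a Brillouin-zone cell on which
`lo ≤ ε(p) ≤ hi` gives `∫_cell blockFloor(ε(p)) ≤ blockFloor lo · W_lo + blockFloor hi · W_hi` with
`W_hi = (∫_cell ε − lo·|cell|)/(hi − lo)`, `W_lo = |cell| − W_hi` — the ENGINE-B / engine-1 cell bound. -/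

/-- **Chord bound.** For `0 ≤ κ ≤ 1` and `lo ≤ ε ≤ hi` (`lo < hi`) the block floor at `ε` lies below the chord
through its values at `lo` and `hi` (convexity, `convexOn_blockFloor`). [folklore] -/
theorem blockFloor_le_chord (U κ α ν lo hi ε : ℝ) (hκ0 : 0 ≤ κ) (hκ1 : κ ≤ 1)
    (hlt : lo < hi) (h1 : lo ≤ ε) (h2 : ε ≤ hi) :
    blockFloor ε U κ α ν ≤
      (hi - ε) / (hi - lo) * blockFloor lo U κ α ν + (ε - lo) / (hi - lo) * blockFloor hi U κ α ν := by
  have hc := convexOn_blockFloor U κ α ν hκ0 hκ1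
  have hd : 0 < hi - lo := sub_pos.mpr hlt
  have ha : 0 ≤ (hi - ε) / (hi - lo) := div_nonneg (sub_nonneg.mpr h2) hd.le
  have hb : 0 ≤ (ε - lo) / (hi - lo) := div_nonneg (sub_nonneg.mpr h1) hd.le
  have hab : (hi - ε) / (hi - lo) + (ε - lo) / (hi - lo) = 1 := by
    rw [← add_div, div_eq_one_iff_eq hd.ne']; ring
  have key := hc.2 (Set.mem_univ lo) (Set.mem_univ hi) ha hb hab
  have hε : (hi - ε) / (hi - lo) * lo + (ε - lo) / (hi - lo) * hi = ε := by
    rw [div_mul_eq_mul_div, div_mul_eq_mul_div, ← add_div, div_eq_iff hd.ne']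
    ring
  simp only [smul_eq_mul, hε] at key
  exact key

/-- Integrated form on a set: if `lo ≤ e p ≤ hi` on a measurable set `c` of finite measure and
`e` is integrable on `c`, then `∫_c blockFloor (e p) ≤ bF lo · W_lo + bF hi · W_hi` with the chord
weights `W_hi = (∫_c e − lo·μ(c))/(hi−lo)`, `W_lo = (hi·μ(c) − ∫_c e)/(hi−lo)`. [folklore] -/
theorem setIntegral_blockFloor_le_chord {X : Type*} [MeasurableSpace X] (μ : MeasureTheory.Measure X)
    (c : Set X) (e : X → ℝ) (U κ α ν lo hi : ℝ) (hκ0 : 0 ≤ κ) (hκ1 : κ ≤ 1) (hlt : lo < hi)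
    (hc : MeasurableSet c) (hμ : μ c ≠ ⊤)
    (he : MeasureTheory.IntegrableOn e c μ)
    (hF : MeasureTheory.IntegrableOn (fun p => blockFloor (e p) U κ α ν) c μ)
    (hlo : ∀ p ∈ c, lo ≤ e p) (hhi : ∀ p ∈ c, e p ≤ hi) :
    ∫ p in c, blockFloor (e p) U κ α ν ∂μ ≤
      blockFloor lo U κ α ν * ((hi * μ.real c - ∫ p in c, e p ∂μ) / (hi - lo)) +
      blockFloor hi U κ α ν * (((∫ p in c, e p ∂μ) - lo * μ.real c) / (hi - lo)) := by
  have hd : 0 < hi - lo := sub_pos.mpr hlt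
  -- pointwise chord bound, written as an affine function of `e p`
  have hpt : ∀ p ∈ c, blockFloor (e p) U κ α ν ≤
      (hi - e p) / (hi - lo) * blockFloor lo U κ α ν + (e p - lo) / (hi - lo) * blockFloor hi U κ α ν :=
    fun p hp => blockFloor_le_chord U κ α ν lo hi (e p) hκ0 hκ1 hlt (hlo p hp) (hhi p hp)
  have hG : MeasureTheory.IntegrableOn
      (fun p => (hi - e p) / (hi - lo) * blockFloor lo U κ α ν + (e p - lo) / (hi - lo) * blockFloor hi U κ α ν) c μ := by
    have hhi0 : MeasureTheory.IntegrableOn (fun _ : X => hi) c μ := MeasureTheory.integrableOn_const hμ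
    have hlo0 : MeasureTheory.IntegrableOn (fun _ : X => lo) c μ := MeasureTheory.integrableOn_const hμ
    have h1 : MeasureTheory.IntegrableOn (fun p => (hi - e p)) c μ := hhi0.sub he
    have h2 : MeasureTheory.IntegrableOn (fun p => (e p - lo)) c μ := he.sub hlo0
    exact ((h1.div_const _).mul_const _).add ((h2.div_const _).mul_const _)
  have hle := MeasureTheory.setIntegral_mono_on hF hG hc hpt
  refine hle.trans (le_of_eq ?_)
  have hhi0 : MeasureTheory.IntegrableOn (fun _ : X => hi) c μ := MeasureTheory.integrableOn_const hμ
  have hlo0 : MeasureTheory.IntegrableOn (fun _ : X => lo) c μ := MeasureTheory.integrableOn_const hμ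
  have h1 : MeasureTheory.IntegrableOn (fun p => (hi - e p)) c μ := hhi0.sub he
  have h2 : MeasureTheory.IntegrableOn (fun p => (e p - lo)) c μ := he.sub hlo0
  rw [MeasureTheory.integral_add ((h1.div_const _).mul_const _) ((h2.div_const _).mul_const _),
    MeasureTheory.integral_mul_const, MeasureTheory.integral_mul_const,
    MeasureTheory.integral_div, MeasureTheory.integral_div,
    MeasureTheory.integral_sub hhi0 he, MeasureTheory.integral_sub he hlo0]
  simp only [MeasureTheory.setIntegral_const, smul_eq_mul]
  ring

end PauliDoublon

end Summit.Ventures.CertifiedManyBodySolver.Lower
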